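import Mathlib
import HarnessLib
import Literature.Analysis.FluidPDE.Tao2016AveragedNS.LocalCascadeSolutions
import Literature.Analysis.FluidPDE.Tao2016AveragedNS.RenormalisedCascadeWaves
import Literature.Analysis.FluidPDE.Tao2016AveragedNS.WeightedLatticeFlows
import Summits.NavierStokesRegularity.NavierStokesRegularity.Theorems.TaoLadderRungTwoBreakBlowupRigidityOneCriticalRiccati

/-!
# Crux `TaoLadderRungTwoBreak.EternalRigidityViscBddOne` (stmt-NavierStokesRegularity-20420): the RICCATI COMPARISON for the
# critical amplitude of the VISCOUS lattice (part 1/2 of the viscous minimal blow-up rate)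

MODEL lattice ODEs only (Tao 2016 §4: the exact NS-scaled `ν`-viscous cascade lattice `∂ₜX_{i,n} = quadTerm_{i,n}(X) −
ν(1+ε₀)^{2n}X_{i,n}` of a table with bounded structure constants, general `m`); nothing here is a statement about the
Navier–Stokes equations; no stub, crux or summit is closed (`--supports stmt-NavierStokesRegularity-20420`).

THE POINT.  The inviscid files `BlowupRigidityOne.CriticalRiccati` / `CriticalRate` / `CriticalBlowup` (⟨20206⟩) prove the standard
LOWER bound `sup_{i,k} Λ^k|X_{i,k}(t)| ≥ 1/(C₁(T⋆−t))` on the blow-up rate of the EXACT lattice by differentiating the supremum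
over the modes (Lipschitz on compact windows).  With dissipation the supremum is no longer Lipschitz uniformly in the shell
(the damping `ν(1+ε₀)^{2k}` is unbounded in `k`), so the argument is re-run here MODE BY MODE: every signed critical amplitude
`±Λ^k X_{i,k}` is fenced by the Riccati solution `B(τ) = A/(1 − C₂A(τ−s))` with Mathlib's
`image_le_of_deriv_right_lt_deriv_boundary'` (at a contact point the dissipative part of the derivative is `−ν(1+ε₀)^{2k}B ≤ 0`
and the quadratic part is `≤ C₁(B+δ)² < C₂B²`, `critical_mul_abs_quadTerm_le_sq`), and the simultaneous control of all modes
needed at the contact point is supplied by REAL INDUCTION (`IsClosed.Icc_subset_of_forall_mem_nhdsWithin`) on the set of times up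
to which every mode is `≤ B + δ` — closed by continuity, open to the right because only finitely many shells can come near `B`
on a compact window (the high shells are small in the critical weight by the (4.5) bound, `critical_tail_lt`; the shells below
`0` vanish).  Template: `MinimalViscousBlowup.ThresholdRay.supLevel_maxPrinciple`.

* `hasDerivWithinAt_Ici_of_viscousClauses` — right-derivatives of the modes from the `C¹`/motion clauses of `ViscousUpTo`;
* `critical_tail_lt` — `(1+(1+ε₀)^{10k})|x| ≤ M`, `k ≥ k₀(M,A,ε₀)` ⟹ `(1+ε₀)^{5k/2}|x| < A`;
* `critical_le_riccati_visc` — **RICCATI COMPARISON (viscous)**: `ν ≥ 0`, `|α| ≤ M_α`, `C₁ = m²M_α(3+Λ) < C₂`; if at time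
  `s ∈ [0,T)` all critical amplitudes are `≤ A` (`A > 0`) then for `s ≤ t < T` with `C₂A(t−s) < 1` they are
  `≤ A/(1 − C₂A(τ−s))` at every `τ ∈ [s,t]`.
Part 2/2 (`…EternalRigidityViscBddOneCriticalRate`): the weight-10 (BKM) bound under a critical bound and the rate theorem
`ViscousUpTo ∧ BlowsUpAt ⟹ sup_{i,k} Λ^k|X_{i,k}(t)|·(t⋆−t) ≥ 1/(16(3+Λ))` — remaining lemma (I) of the (ω4) census of ⟨20420⟩.
HONEST LABEL: (ω3), (ω4), ⟨20420⟩ and every NS statement remain OPEN; rung 0.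
-/

noncomputable section

-- the summit and its single sub-problem share the name (CONVENTIONS §1)
set_option linter.dupNamespace false

open Set Filter Topology
open Literature.Analysis.FluidPDE Literature.Analysis.FluidPDE.TaoCascade
open Summit.NavierStokesRegularity.NavierStokesRegularity.Theorems.BlowupRigidityOne

namespace Summit.NavierStokesRegularity.NavierStokesRegularity.Theorems.EternalRigidityViscBddOne.CriticalRate

variable {m : ℕ}

/-! ### Clause glue -/

/-- Right-derivative of a mode of a regular `ν`-viscous trajectory on `[0,T)` (from the `C¹` clause on `[0,T)` and the
one-sided motion law within `[0,∞)`), within `[t,∞)` at every `t ∈ [0,T)`.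
[cite: Tao2016AveragedNS, §4, the viscous equation before Thm. 4.2; cell vocabulary (`ViscousUpTo`)] -/
theorem hasDerivWithinAt_Ici_of_viscousClauses {ε₀ ν T : ℝ} {α : Fin m → Fin m → Fin m → ℤ × ℤ × ℤ → ℝ}
    {X : Fin m → ℤ → ℝ → ℝ} (hcd : ∀ i n, ContDiffOn ℝ 1 (X i n) (Ico 0 T))
    (hmot : ∀ i n t, 0 ≤ t → t < T → derivWithin (X i n) (Ici 0) t =
      quadTerm ε₀ α X i n t - ν * (1 + ε₀) ^ ((2 : ℝ) * n) * X i n t)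
    (i : Fin m) (k : ℤ) {t : ℝ} (ht : t ∈ Ico 0 T) :
    HasDerivWithinAt (X i k) (quadTerm ε₀ α X i k t - ν * (1 + ε₀) ^ ((2 : ℝ) * k) * X i k t) (Ici t) t := by
  have hd : DifferentiableWithinAt ℝ (X i k) (Ico 0 T) t :=
    ((hcd i k).differentiableOn one_ne_zero) t ht
  have hd' : DifferentiableWithinAt ℝ (X i k) (Ici 0) t :=
    hd.mono_of_mem_nhdsWithin (by
      rw [mem_nhdsWithin]
      exact ⟨Iio T, isOpen_Iio, ht.2, fun x hx => ⟨hx.2, hx.1⟩⟩)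
  rw [← hmot i k t ht.1 ht.2]
  exact hd'.hasDerivWithinAt.mono (Ici_subset_Ici.2 ht.1)

/-! ### High shells are small in the critical weight -/

/-- **Critical tail.**  For `ε₀ > 0`, `M ≥ 0`, `A > 0` there is `k₀` such that a weight-10 bound `(1+(1+ε₀)^{10k})|x| ≤ M` at a
shell `k ≥ k₀` forces the critical amplitude `(1+ε₀)^{5k/2}|x| < A` (`(1+ε₀)^{5k/2−10k} M → 0`).
[cite: Tao2016AveragedNS, §4 Lemma 4.1 (4.5) (the a priori weight) and (4.1) (the critical weight `(1+ε₀)^{5n/2}`)] -/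
theorem critical_tail_lt {ε₀ M A : ℝ} (hε : 0 < ε₀) (hA : 0 < A) :
    ∃ k₀ : ℕ, ∀ k : ℤ, (k₀ : ℤ) ≤ k → ∀ x : ℝ, (1 + (1 + ε₀) ^ ((10 : ℝ) * k)) * |x| ≤ M →
      (1 + ε₀) ^ ((5 : ℝ) * k / 2) * |x| < A := by
  have hl0 : (0 : ℝ) < 1 + ε₀ := by linarith
  have hl1 : (1 : ℝ) < 1 + ε₀ := by linarith
  have hb : (1 : ℝ) < (1 + ε₀) ^ ((15 : ℝ) / 2) := Real.one_lt_rpow hl1 (by norm_num)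
  obtain ⟨k₀, hk₀⟩ := pow_unbounded_of_one_lt (M / A) hb
  refine ⟨k₀, fun k hk x hx => ?_⟩
  have hx0 : 0 ≤ |x| := abs_nonneg x
  have hW : (1 + ε₀) ^ ((10 : ℝ) * k) * |x| ≤ M := by
    have h1 : (1 + ε₀) ^ ((10 : ℝ) * k) * |x| ≤ (1 + (1 + ε₀) ^ ((10 : ℝ) * k)) * |x| :=
      mul_le_mul_of_nonneg_right (by linarith) hx0
    exact h1.trans hx
  -- `(1+ε₀)^{5k/2} = (1+ε₀)^{-15k/2} (1+ε₀)^{10k}`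
  have hsplit : (1 + ε₀) ^ ((5 : ℝ) * k / 2) = (1 + ε₀) ^ (-((15 : ℝ) / 2 * k)) * (1 + ε₀) ^ ((10 : ℝ) * k) := by
    rw [← Real.rpow_add hl0]; congr 1; ring
  -- `(1+ε₀)^{-15k/2} ≤ (1+ε₀)^{-15k₀/2} = 1/((1+ε₀)^{15/2})^{k₀}`
  have hk' : (k₀ : ℝ) ≤ k := by exact_mod_cast hk
  have hmono : (1 + ε₀) ^ (-((15 : ℝ) / 2 * k)) ≤ (1 + ε₀) ^ (-((15 : ℝ) / 2 * k₀)) :=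
    Real.rpow_le_rpow_of_exponent_le hl1.le (by nlinarith)
  have hpow : (1 + ε₀) ^ (-((15 : ℝ) / 2 * k₀)) = (((1 + ε₀) ^ ((15 : ℝ) / 2)) ^ k₀)⁻¹ := by
    rw [Real.rpow_neg hl0.le, Real.rpow_mul_natCast hl0.le]
  have hQ : 0 < ((1 + ε₀) ^ ((15 : ℝ) / 2)) ^ k₀ := pow_pos (by positivity) _
  have hMA : M < A * ((1 + ε₀) ^ ((15 : ℝ) / 2)) ^ k₀ := by
    rw [div_lt_iff₀ hA] at hk₀; linarith [mul_comm (((1 + ε₀) ^ ((15 : ℝ) / 2)) ^ k₀) A]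
  calc (1 + ε₀) ^ ((5 : ℝ) * k / 2) * |x|
      = (1 + ε₀) ^ (-((15 : ℝ) / 2 * k)) * ((1 + ε₀) ^ ((10 : ℝ) * k) * |x|) := by rw [hsplit, mul_assoc]
    _ ≤ (1 + ε₀) ^ (-((15 : ℝ) / 2 * k₀)) * M :=
        mul_le_mul hmono hW (by positivity) (Real.rpow_nonneg hl0.le _)
    _ = M / ((1 + ε₀) ^ ((15 : ℝ) / 2)) ^ k₀ := by rw [hpow, inv_mul_eq_div]
    _ < A := by rw [div_lt_iff₀ hQ]; exact hMA


/-! ### The Riccati comparison, mode by mode, by real induction -/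

/-- **RICCATI COMPARISON for the `ν`-viscous lattice.**  Structure constants bounded by `M_α`, `ε₀ > 0`, `ν ≥ 0`,
`C₁ = m² M_α (3 + Λ) < C₂` (`Λ = bigLam ε₀`).  Let `X` be a regular trajectory of the exact `ν`-viscous lattice on `[0,T)`
(`C¹` on `[0,T)`, one-sided motion law, no shells below `0`, (4.5)-regular on every `[0,T']`, `T' < T` — the clauses of
`ViscousUpTo`).  If at a time `s ∈ [0,T)` every critical amplitude satisfies `(1+ε₀)^{5k/2}|X_{i,k}(s)| ≤ A` (`A > 0`), then for
every `t ∈ [s,T)` with `C₂A(t−s) < 1` and every `τ ∈ [s,t]`: `(1+ε₀)^{5k/2}|X_{i,k}(τ)| ≤ A/(1 − C₂A(τ−s))`.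
(Fences `±(1+ε₀)^{5k/2}X_{i,k} ≤ B`, `B' = C₂B²`, for the finitely many shells that can approach `B` on `[0,t]`; the dissipation
only helps at a contact point; real induction on «all modes `≤ B + δ` so far».)
[cite: Teschl2012, §2.6 (maximal solutions, blow-up rate); Tao2016AveragedNS, §4 (4.8) and the viscous equation before Thm. 4.2] -/
theorem critical_le_riccati_visc {ε₀ ν Mα T : ℝ} (hε : 0 < ε₀) (hν : 0 ≤ ν) (hMα : 0 ≤ Mα)
    {α : Fin m → Fin m → Fin m → ℤ × ℤ × ℤ → ℝ} (hα : ∀ i₁ i₂ i₃ μ, |α i₁ i₂ i₃ μ| ≤ Mα)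
    {X : Fin m → ℤ → ℝ → ℝ} (hcd : ∀ i n, ContDiffOn ℝ 1 (X i n) (Ico 0 T))
    (hmot : ∀ i n t, 0 ≤ t → t < T → derivWithin (X i n) (Ici 0) t =
      quadTerm ε₀ α X i n t - ν * (1 + ε₀) ^ ((2 : ℝ) * n) * X i n t)
    (hlow : ∀ i n t, n < 0 → 0 ≤ t → t < T → X i n t = 0)
    (hreg : ∀ T' : ℝ, 0 < T' → T' < T → ∃ M : ℝ, ∀ t : ℝ, 0 ≤ t → t ≤ T' →
      ∀ (i : Fin m) (n : ℤ), (1 + (1 + ε₀) ^ ((10 : ℝ) * n)) * |X i n t| ≤ M)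
    {s A C₂ t : ℝ} (hs : s ∈ Ico 0 T) (hA : 0 < A)
    (hAs : ∀ (i : Fin m) (k : ℤ), (1 + ε₀) ^ ((5 : ℝ) * k / 2) * |X i k s| ≤ A)
    (hC₂ : (m : ℝ) ^ 2 * Mα * (3 + bigLam ε₀) < C₂) (hst : s ≤ t) (htT : t < T)
    (hgap : C₂ * A * (t - s) < 1) :
    ∀ τ ∈ Icc s t, ∀ (i : Fin m) (k : ℤ),
      (1 + ε₀) ^ ((5 : ℝ) * k / 2) * |X i k τ| ≤ A / (1 - C₂ * A * (τ - s)) := by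
  set C₁ : ℝ := (m : ℝ) ^ 2 * Mα * (3 + bigLam ε₀) with hC₁def
  have hl0 : (0 : ℝ) < 1 + ε₀ := by linarith
  have hLam : 0 < bigLam ε₀ := bigLam_pos (by linarith)
  have hC₁0 : 0 ≤ C₁ := by positivity
  have hC₂0 : 0 < C₂ := lt_of_le_of_lt hC₁0 hC₂
  set P : ℤ → ℝ := fun k => (1 + ε₀) ^ ((5 : ℝ) * k / 2) with hPdef
  have hP0 : ∀ k, 0 < P k := fun k => Real.rpow_pos_of_pos hl0 _
  -- the Riccati solution `B(τ) = A / (1 - C₂ A (τ - s))`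
  set g : ℝ → ℝ := fun τ => 1 - C₂ * A * (τ - s) with hgdef
  set B : ℝ → ℝ := fun τ => A / g τ with hBdef
  have hgpos : ∀ τ, τ ≤ t → 0 < g τ := fun τ hτ => by
    simp only [hgdef]
    have : C₂ * A * (τ - s) ≤ C₂ * A * (t - s) :=
      mul_le_mul_of_nonneg_left (by linarith) (mul_pos hC₂0 hA).le
    linarith
  have hgle : ∀ τ, s ≤ τ → g τ ≤ 1 := fun τ hτ => by
    simp only [hgdef]
    nlinarith [mul_pos hC₂0 hA]
  have hBA : ∀ τ ∈ Icc s t, A ≤ B τ := fun τ hτ => by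
    simp only [hBdef]
    rw [le_div_iff₀ (hgpos τ hτ.2)]
    nlinarith [hgle τ hτ.1]
  have hBpos : ∀ τ ∈ Icc s t, 0 < B τ := fun τ hτ => lt_of_lt_of_le hA (hBA τ hτ)
  have hBs : B s = A := by simp [hBdef, hgdef]
  have hg' : ∀ τ, HasDerivAt g (-(C₂ * A)) τ := fun τ => by
    have h := ((hasDerivAt_id τ).sub_const s).const_mul (C₂ * A)
    have h2 := h.const_sub 1
    rw [mul_one] at h2
    exact h2
  have hBat : ∀ τ, τ ≤ t → HasDerivAt B (C₂ * B τ ^ 2) τ := fun τ hτ => by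
    have hgτ : g τ ≠ 0 := (hgpos τ hτ).ne'
    have hB' : HasDerivAt B ((0 * g τ - A * -(C₂ * A)) / g τ ^ 2) τ :=
      (hasDerivAt_const τ A).div (hg' τ) hgτ
    refine hB'.congr_deriv ?_
    have hnum : (0 * g τ - A * -(C₂ * A)) = C₂ * A ^ 2 := by ring
    rw [hnum]
    show C₂ * A ^ 2 / g τ ^ 2 = C₂ * (A / g τ) ^ 2
    rw [div_pow, mul_div_assoc]
  have hBcontAt : ∀ τ, τ ≤ t → ContinuousAt B τ := fun τ hτ => (hBat τ hτ).continuousAt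
  have hBcont : ∀ a b, b ≤ t → ContinuousOn B (Icc a b) := fun a b hb τ hτ =>
    (hBcontAt τ (hτ.2.trans hb)).continuousWithinAt
  -- `δ > 0` with `C₁ (1 + δ/A)² < C₂`
  have hδev : ∀ᶠ δ in 𝓝[>] (0 : ℝ), C₁ * (1 + δ / A) ^ 2 < C₂ := by
    have hc : ContinuousAt (fun δ : ℝ => C₁ * (1 + δ / A) ^ 2) 0 := by fun_prop
    have hlim : Tendsto (fun δ : ℝ => C₁ * (1 + δ / A) ^ 2) (𝓝[>] 0) (𝓝 (C₁ * (1 + 0 / A) ^ 2)) :=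
      hc.tendsto.mono_left nhdsWithin_le_nhds
    refine hlim (Iio_mem_nhds ?_)
    simpa using hC₂
  obtain ⟨δ, hδC, hδ⟩ := (hδev.and self_mem_nhdsWithin).exists
  have hδ : 0 < δ := hδ
  -- quadratic bound at a contact point: `C₁ (B τ + δ)² < C₂ (B τ)²`
  have hcontact : ∀ τ ∈ Icc s t, C₁ * (B τ + δ) ^ 2 < C₂ * B τ ^ 2 := by
    intro τ hτ
    have hB0 := hBpos τ hτ
    have h1 : B τ + δ ≤ (1 + δ / A) * B τ := by
      rw [add_mul, one_mul, add_le_add_iff_left, div_mul_eq_mul_div, le_div_iff₀ hA]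
      exact mul_le_mul_of_nonneg_left (hBA τ hτ) hδ.le
    have h2 : (B τ + δ) ^ 2 ≤ ((1 + δ / A) * B τ) ^ 2 :=
      pow_le_pow_left₀ (by linarith) h1 2
    calc C₁ * (B τ + δ) ^ 2 ≤ C₁ * ((1 + δ / A) * B τ) ^ 2 := mul_le_mul_of_nonneg_left h2 hC₁0
      _ = C₁ * (1 + δ / A) ^ 2 * B τ ^ 2 := by ring
      _ < C₂ * B τ ^ 2 := mul_lt_mul_of_pos_right hδC (pow_pos hB0 2)
  -- the window `[0,T']`, `T' = (t+T)/2`, and its weight-10 bound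
  set T' : ℝ := (t + T) / 2 with hT'
  have hT'0 : 0 < T' := by rw [hT']; linarith [hs.1, hs.2]
  have htT' : t < T' := by rw [hT']; linarith
  have hT'T : T' < T := by rw [hT']; linarith
  obtain ⟨M₀, hM₀⟩ := hreg T' hT'0 hT'T
  -- tail shells: critical amplitude `< A` on `[0,T']`
  obtain ⟨k₀, hk₀⟩ := critical_tail_lt (M := M₀) hε hA
  have htail : ∀ τ, 0 ≤ τ → τ ≤ T' → ∀ (i : Fin m) (k : ℤ), (k₀ : ℤ) ≤ k → P k * |X i k τ| < A :=
    fun τ hτ0 hτT' i k hk => hk₀ k hk (X i k τ) (hM₀ τ hτ0 hτT' i k)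
  clear_value T'
  -- continuity and right-derivatives of the modes
  have hXc : ∀ (i : Fin m) (k : ℤ), ContinuousOn (X i k) (Icc s t) := fun i k =>
    (hcd i k).continuousOn.mono fun w hw => ⟨hs.1.trans hw.1, lt_of_le_of_lt hw.2 htT⟩
  have hder : ∀ (i : Fin m) (k : ℤ), ∀ τ ∈ Ico s t, HasDerivWithinAt (X i k)
      (quadTerm ε₀ α X i k τ - ν * (1 + ε₀) ^ ((2 : ℝ) * k) * X i k τ) (Ici τ) τ := fun i k τ hτ =>
    hasDerivWithinAt_Ici_of_viscousClauses hcd hmot i k ⟨hs.1.trans hτ.1, lt_trans hτ.2 htT⟩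
  -- reading a weak bound on all modes from a weak bound on the finitely many low shells
  have hread : ∀ y ∈ Icc s t, (∀ τ ∈ Icc s y, ∀ (i : Fin m) (k : ℕ), k < k₀ →
      P k * |X i k τ| ≤ B τ + δ) → ∀ τ ∈ Icc s y, ∀ (i : Fin m) (k : ℤ), P k * |X i k τ| ≤ B τ + δ := by
    intro y hy hyp τ hτ i k
    have hτt : τ ∈ Icc s t := ⟨hτ.1, hτ.2.trans hy.2⟩
    have hBτ := hBpos τ hτt
    rcases lt_or_ge k 0 with hk | hk
    · rw [hlow i k τ hk (hs.1.trans hτ.1) (lt_of_le_of_lt hτt.2 htT), abs_zero, mul_zero]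
      linarith
    · obtain ⟨n, rfl⟩ := Int.eq_ofNat_of_zero_le hk
      by_cases hn : n < k₀
      · exact hyp τ hτ i n hn
      · have := htail τ (hs.1.trans hτ.1) (hτt.2.trans htT'.le) i n (by exact_mod_cast not_lt.1 hn)
        linarith [hBA τ hτt]
  -- BOOTSTRAP: weak bound on `[s,y]` ⇒ Riccati bound on `[s,y]`
  have himp : ∀ y ∈ Icc s t, (∀ τ ∈ Icc s y, ∀ (i : Fin m) (k : ℤ), P k * |X i k τ| ≤ B τ + δ) →
      ∀ τ ∈ Icc s y, ∀ (i : Fin m) (k : ℤ), P k * |X i k τ| ≤ B τ := by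
    intro y hy hweak τ hτ i k
    -- signed fences
    have hfence : ∀ σ : ℝ, (σ = 1 ∨ σ = -1) → σ * (P k * X i k τ) ≤ B τ := by
      intro σ hσ
      have hσ1 : |σ| = 1 := by rcases hσ with rfl | rfl <;> simp
      set f : ℝ → ℝ := fun w => σ * (P k * X i k w) with hfdef
      set f' : ℝ → ℝ := fun w => σ * (P k * (quadTerm ε₀ α X i k w -
        ν * (1 + ε₀) ^ ((2 : ℝ) * k) * X i k w)) with hf'def
      have hfc : ContinuousOn f (Icc s y) :=
        (continuousOn_const.mul (continuousOn_const.mul ((hXc i k).mono (Icc_subset_Icc le_rfl hy.2))))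
      have hfd : ∀ w ∈ Ico s y, HasDerivWithinAt f (f' w) (Ici w) w := fun w hw =>
        ((hder i k w ⟨hw.1, lt_of_lt_of_le hw.2 hy.2⟩).const_mul (P k)).const_mul σ
      have hfs : f s ≤ B s := by
        rw [hBs]
        calc f s ≤ |f s| := le_abs_self _
          _ = P k * |X i k s| := by
              simp only [hfdef, abs_mul, hσ1, one_mul, abs_of_pos (hP0 k)]
          _ ≤ A := hAs i k
      have hBd : ∀ w ∈ Ico s y, HasDerivWithinAt B (C₂ * B w ^ 2) (Ici w) w := fun w hw =>
        (hBat w (hw.2.le.trans hy.2)).hasDerivWithinAt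
      have hbound : ∀ w ∈ Ico s y, f w = B w → f' w < C₂ * B w ^ 2 := by
        intro w hw hfw
        have hwt : w ∈ Icc s t := ⟨hw.1, hw.2.le.trans hy.2⟩
        have hall := hweak w ⟨hw.1, hw.2.le⟩
        have hq := critical_mul_abs_quadTerm_le_sq hε.le hMα (by linarith [hBpos w hwt]) hα hall i k
        -- the dissipative part is `-ν (1+ε₀)^{2k} B w ≤ 0`
        have hdis : 0 ≤ ν * (1 + ε₀) ^ ((2 : ℝ) * k) * (σ * (P k * X i k w)) := by
          have : σ * (P k * X i k w) = B w := hfw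
          rw [this]
          exact mul_nonneg (mul_nonneg hν (Real.rpow_nonneg hl0.le _)) (hBpos w hwt).le
        have hquad : σ * (P k * quadTerm ε₀ α X i k w) ≤ P k * |quadTerm ε₀ α X i k w| := by
          calc σ * (P k * quadTerm ε₀ α X i k w) ≤ |σ * (P k * quadTerm ε₀ α X i k w)| := le_abs_self _
            _ = P k * |quadTerm ε₀ α X i k w| := by
                rw [abs_mul, hσ1, one_mul, abs_mul, abs_of_pos (hP0 k)]
        have hf'le : f' w ≤ P k * |quadTerm ε₀ α X i k w| := by
          have : f' w = σ * (P k * quadTerm ε₀ α X i k w) -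
              ν * (1 + ε₀) ^ ((2 : ℝ) * k) * (σ * (P k * X i k w)) := by
            simp only [hf'def]; ring
          rw [this]; linarith
        calc f' w ≤ P k * |quadTerm ε₀ α X i k w| := hf'le
          _ ≤ C₁ * (B w + δ) ^ 2 := hq
          _ < C₂ * B w ^ 2 := hcontact w hwt
      exact image_le_of_deriv_right_lt_deriv_boundary' hfc hfd hfs (hBcont s y hy.2) hBd hbound hτ
    have h1 := hfence 1 (Or.inl rfl)
    have h2 := hfence (-1) (Or.inr rfl)
    rw [one_mul] at h1
    rw [neg_one_mul] at h2
    rw [← abs_of_pos (hP0 k), ← abs_mul]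
    exact abs_le.2 ⟨by linarith, h1⟩
  -- REAL INDUCTION on the weak bound for the low shells (clamped form)
  set H : Set ℝ := {y | ∀ τ ∈ Icc s t, ∀ (i : Fin m) (k : ℕ), k < k₀ →
      P k * |X i k (min τ y)| ≤ B (min τ y) + δ} with hH
  have hHweak : ∀ y ∈ Icc s t, y ∈ H → ∀ τ ∈ Icc s y, ∀ (i : Fin m) (k : ℤ),
      P k * |X i k τ| ≤ B τ + δ := by
    intro y hy hyH
    refine hread y hy fun τ hτ i k hk => ?_
    have := hyH τ ⟨hτ.1, hτ.2.trans hy.2⟩ i k hk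
    rwa [min_eq_left hτ.2] at this
  have h0H : s ∈ H := by
    intro τ hτ i k _
    rw [min_eq_right hτ.1, hBs]
    linarith [hAs i k]
  have hclosed : IsClosed (H ∩ Icc s t) := by
    have hlevc : ∀ τ ∈ Icc s t, ∀ (i : Fin m) (k : ℕ),
        ContinuousOn (fun y => P k * |X i k (min τ y)| - B (min τ y)) (Icc s t) := by
      intro τ hτ i k
      have hmin : ContinuousOn (fun y : ℝ => min τ y) (Icc s t) := (continuous_const.min continuous_id).continuousOn
      have hmaps : MapsTo (fun y : ℝ => min τ y) (Icc s t) (Icc s t) := fun y hy =>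
        ⟨le_min hτ.1 hy.1, (min_le_right _ _).trans hy.2⟩
      exact (continuousOn_const.mul (((hXc i k).comp hmin hmaps).abs)).sub ((hBcont s t le_rfl).comp hmin hmaps)
    have heq : H ∩ Icc s t = Icc s t ∩ ⋂ τ ∈ Icc s t, ⋂ i : Fin m, ⋂ k ∈ {k : ℕ | k < k₀},
        (Icc s t ∩ (fun y => P k * |X i k (min τ y)| - B (min τ y)) ⁻¹' Iic δ) := by
      ext y
      simp only [hH, mem_inter_iff, mem_iInter, mem_setOf_eq, mem_preimage, mem_Iic, sub_le_iff_le_add, add_comm]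
      constructor
      · rintro ⟨hyH, hy⟩
        exact ⟨hy, fun τ hτ i k hk => ⟨hy, hyH τ hτ i k hk⟩⟩
      · rintro ⟨hy, h⟩
        exact ⟨fun τ hτ i k hk => (h τ hτ i k hk).2, hy⟩
    rw [heq]
    exact isClosed_Icc.inter (isClosed_biInter fun τ hτ => isClosed_iInter fun i => isClosed_biInter fun k _ =>
      (hlevc τ hτ i k).preimage_isClosed_of_isClosed isClosed_Icc isClosed_Iic)
  have hstep : ∀ y ∈ H ∩ Ico s t, H ∈ 𝓝[>] y := by
    rintro y ⟨hyH, hy⟩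
    have hyI : y ∈ Icc s t := Ico_subset_Icc_self hy
    have hstrong := himp y hyI (hHweak y hyI hyH)
    have hy0 : 0 ≤ y := hs.1.trans hy.1
    have hyT : y < T := lt_trans hy.2 htT
    -- continuity from the right at `y` of every `P k |X i k| - B`
    have hcw : ∀ (i : Fin m) (k : ℕ), Tendsto (fun z => P k * |X i k z| - B z) (𝓝[>] y)
        (𝓝 (P k * |X i k y| - B y)) := by
      intro i k
      have hXw : ContinuousWithinAt (X i k) (Ioi y) y :=
        ((hcd i k).continuousOn y ⟨hy0, hyT⟩).mono_of_mem_nhdsWithin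
          (mem_of_superset (Ioo_mem_nhdsGT hyT) fun z hz => ⟨hy0.trans hz.1.le, hz.2⟩)
      have hBw : ContinuousWithinAt B (Ioi y) y := (hBcontAt y hy.2.le).continuousWithinAt
      exact ((hXw.abs.const_mul (P k)).sub hBw).tendsto
    have hev : ∀ᶠ z in 𝓝[>] y, ∀ i : Fin m, ∀ k ∈ Finset.range k₀, P k * |X i k z| - B z < δ := by
      refine eventually_all.2 fun i => (eventually_all_finset _).2 fun k _ => ?_
      have hlt : P k * |X i k y| - B y < δ := by linarith [hstrong y ⟨hy.1, le_rfl⟩ i k]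
      exact (hcw i k).eventually_lt_const hlt
    obtain ⟨u, hu, hsub⟩ := mem_nhdsGT_iff_exists_Ioo_subset.1 hev
    refine mem_of_superset (Ioo_mem_nhdsGT hu) fun z hz => ?_
    intro τ hτ i k hk
    rcases le_or_gt (min τ z) y with h | h
    · have := hyH (min τ z) ⟨le_min hτ.1 (hy.1.trans hz.1.le), (min_le_left _ _).trans hτ.2⟩ i k hk
      rwa [min_eq_left h] at this
    · have hmem : min τ z ∈ Ioo y u := ⟨h, lt_of_le_of_lt (min_le_right _ _) hz.2⟩
      have := hsub hmem i k (Finset.mem_range.2 hk)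
      linarith
  have hIcc : Icc s t ⊆ H := hclosed.Icc_subset_of_forall_mem_nhdsWithin h0H hstep
  intro τ hτ i k
  exact himp t ⟨hst, le_rfl⟩ (hHweak t ⟨hst, le_rfl⟩ (hIcc ⟨hst, le_rfl⟩)) τ hτ i k

end Summit.NavierStokesRegularity.NavierStokesRegularity.Theorems.EternalRigidityViscBddOne.CriticalRate

end
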